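import Literature.NumberTheory.EllipticCurves.WeierstrassSigmaProofs
import Mathlib.Analysis.Complex.Liouville
import Mathlib.Analysis.Calculus.Deriv.Shift
import Mathlib.Analysis.Calculus.DSlope
import Mathlib.Analysis.Analytic.IsolatedZeros

/-!
# Crux `RealOnePeriodRelations` (stmt-KontsevichZagierPeriods-10042) — stub `stub_ellipticLiouville`
# (line `nash-retraction-thin-strip`, reshape 10: the torsion / third-kind layer)

**There is no elliptic function of order one**, in the removable-singularity form used by the
torsion layer: if `r` is analytic off `Λ ∪ (v + Λ)` (`v ∉ Λ`), `Λ`-periodic there, agrees near `0`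
with a function analytic at `0`, and near `v` with `F z / (z - v)` (`F` analytic at `v`), then `r`
is constant off `Λ ∪ (v + Λ)`.

Proof (Legendre relation + Liouville, no residues).  Put `a = F v` and
`R z = r z - a ζ(z - v)` (`ζ` the Weierstrass zeta function of `Λ`).  Since `ζ(w) - 1/w` is
analytic at `0` (from `σ = z · φ`, `φ` entire, `φ(0) = 1`, `σ'/σ = ζ`), `R` agrees near `v` and
near `0` with analytic functions; by the periodicity of `r` and the quasi-periodicity
`ζ(w + ωᵢ) = ζ(w) + ηᵢ` the same holds at every point of `Λ ∪ (v + Λ)`, so `R` extends to an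
entire function `R̃` with `R̃(z + ωᵢ) = R̃(z) - a ηᵢ`.  Then `R̃'` is entire and `Λ`-periodic, hence
constant (`IsZLattice.isCompact_range_of_periodic`, Liouville), `R̃ z = b z + d`, `b ωᵢ = -a ηᵢ`,
so `a (η₁ω₂ - η₂ω₁) = 0`; Legendre's relation `η₁ω₂ - η₂ω₁ = ±2πi` gives `a = 0`, then `b = 0`.

[cite: WhittakerWatson1927, §20.12, §20.411, §20.42] [cite: SilvermanAEC2009, VI.2.1, VI.3.1]
-/

noncomputable section

open scoped BigOperators Topology PeriodPair
open Set Filter Complex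

namespace Summit.KontsevichZagierPeriods.SymplecticScissors.RealOnePeriodRelations.TorsionLayer

namespace EllipticLiouville

/-! ## Analytic helpers (reusable): punctured-neighbourhood bookkeeping, entire extensions,
lattice induction, Liouville for period defects, `ζ(w) - 1/w` at `0` -/

/-- Two functions continuous at `z` that agree on a punctured neighbourhood of `z` agree at `z`.
[folklore] -/
theorem eq_of_eventuallyEq_nhdsNE {f g : ℂ → ℂ} {z : ℂ} (hf : ContinuousAt f z)
    (hg : ContinuousAt g z) (h : f =ᶠ[𝓝[≠] z] g) : f z = g z :=
  tendsto_nhds_unique (hf.tendsto.mono_left nhdsWithin_le_nhds)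
    ((hg.tendsto.mono_left nhdsWithin_le_nhds).congr' h.symm)

/-- Translation maps punctured neighbourhoods to punctured neighbourhoods. [folklore] -/
theorem tendsto_sub_const_nhdsNE (z₀ ω : ℂ) :
    Tendsto (fun z : ℂ => z - ω) (𝓝[≠] (z₀ + ω)) (𝓝[≠] z₀) := by
  refine tendsto_nhdsWithin_iff.mpr ⟨?_, ?_⟩
  · exact ((continuous_sub_right ω).tendsto' (z₀ + ω) z₀ (add_sub_cancel_right z₀ ω)).mono_left
      nhdsWithin_le_nhds
  · filter_upwards [self_mem_nhdsWithin] with z hz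
    rw [mem_compl_iff, mem_singleton_iff] at hz ⊢
    exact fun h => hz (by linear_combination h)

/-- The translates `v + Λ` of a period lattice do not accumulate: every point has a punctured
neighbourhood avoiding `v + Λ`. [folklore] -/
theorem eventually_sub_notMem_lattice (L : PeriodPair) (v z₀ : ℂ) :
    ∀ᶠ z in 𝓝[≠] z₀, z - v ∉ L.lattice := by
  have h1 : (fun z : ℂ => z - v) ⁻¹' ((L.lattice : Set ℂ) \ {z₀ - v})ᶜ ∈ 𝓝 z₀ :=
    (continuous_sub_right v).continuousAt.preimage_mem_nhds
      (L.compl_lattice_sdiff_singleton_mem_nhds (z₀ - v))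
  rw [eventually_nhdsWithin_iff]
  filter_upwards [h1] with z hz hne hmem
  simp only [mem_preimage, mem_compl_iff, Set.mem_sdiff, mem_singleton_iff, not_and, not_not]
    at hz hne
  exact hne (sub_left_injective (hz hmem))

/-- **Removable singularities everywhere give an entire function.**  If at every point `z` the
function `f` agrees on a punctured neighbourhood with some function analytic at `z`, then there is
an entire `F` whose value at each `z` is the value of any such local representative (in particular
`F = f` wherever `f` is analytic). [folklore] -/
theorem exists_differentiable_extension (f : ℂ → ℂ)
    (h : ∀ z : ℂ, ∃ g : ℂ → ℂ, AnalyticAt ℂ g z ∧ f =ᶠ[𝓝[≠] z] g) :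
    ∃ F : ℂ → ℂ, Differentiable ℂ F ∧
      ∀ (z : ℂ) (g : ℂ → ℂ), AnalyticAt ℂ g z → f =ᶠ[𝓝[≠] z] g → F z = g z := by
  choose G hG using h
  have key : ∀ (z : ℂ) (g : ℂ → ℂ), AnalyticAt ℂ g z → f =ᶠ[𝓝[≠] z] g → G z z = g z :=
    fun z g hg hfg => eq_of_eventuallyEq_nhdsNE (hG z).1.continuousAt hg.continuousAt
      ((hG z).2.symm.trans hfg)
  refine ⟨fun z => G z z, fun z₀ => ?_, key⟩
  have h1 : ∀ᶠ z in 𝓝 z₀, AnalyticAt ℂ (G z₀) z := (hG z₀).1.eventually_analyticAt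
  have h2 := (eventually_nhdsWithin_iff.mp (hG z₀).2).eventually_nhds
  have h3 : (fun z => G z z) =ᶠ[𝓝 z₀] G z₀ := by
    filter_upwards [h1, h2] with z hz1 hz2
    refine key z (G z₀) hz1 ?_
    by_cases hz : z = z₀
    · subst hz
      exact (hG z).2
    · have h4 : ({z₀}ᶜ : Set ℂ) ∈ 𝓝 z := isOpen_compl_singleton.mem_nhds hz
      refine eventually_nhdsWithin_iff.mpr ?_
      filter_upwards [hz2, h4] with w hw hw4 _ using hw hw4
  exact ((hG z₀).1.congr h3.symm).differentiableAt

/-- Induction over the period lattice: a property of points of `ℂ` invariant under `z ↦ z + ω₁`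
and `z ↦ z + ω₂` (as an `↔`) is invariant under every period. [folklore] -/
theorem lattice_induction_iff (L : PeriodPair) (S : Set ℂ)
    (h₁ : ∀ z, z ∈ S ↔ z + L.ω₁ ∈ S) (h₂ : ∀ z, z ∈ S ↔ z + L.ω₂ ∈ S) :
    ∀ l ∈ L.lattice, ∀ z, z ∈ S ↔ z + l ∈ S := by
  intro l hl
  induction hl using Submodule.span_induction with
  | mem x hx =>
    rcases hx with rfl | rfl
    · exact h₁
    · exact h₂
  | zero => simp
  | add x y _ _ hx hy => intro z; rw [← add_assoc, ← hy, ← hx]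
  | smul n x _ hx =>
    intro z
    induction n using Int.induction_on generalizing z with
    | zero => simp
    | succ i ih => rw [add_smul, one_smul, ← add_assoc, ← hx, ← ih]
    | pred i ih =>
      rw [sub_smul, one_smul, ih z, hx (z + (-(i : ℤ) • x - x)), add_assoc, sub_add_cancel]

/-- An entire function with constant period defects, `Φ(z + ωᵢ) = Φ(z) + cᵢ`, is affine:
its derivative is an entire `Λ`-periodic function, hence bounded on `ℂ`
(`IsZLattice.isCompact_range_of_periodic`) and constant by Liouville's theorem. [folklore] -/
theorem entire_add_period (L : PeriodPair) {Φ : ℂ → ℂ} (hΦ : Differentiable ℂ Φ) {c₁ c₂ : ℂ}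
    (h₁ : ∀ z, Φ (z + L.ω₁) = Φ z + c₁) (h₂ : ∀ z, Φ (z + L.ω₂) = Φ z + c₂) :
    ∃ b : ℂ, (∀ z, Φ z = b * z + Φ 0) ∧ b * L.ω₁ = c₁ ∧ b * L.ω₂ = c₂ := by
  set D : ℂ → ℂ := deriv Φ with hD
  have hDd : Differentiable ℂ D := fun z => (hΦ.analyticAt z).deriv.differentiableAt
  have hDω : ∀ {ω c : ℂ}, (∀ z, Φ (z + ω) = Φ z + c) → ∀ z, D (z + ω) = D z := by
    intro ω c h z
    have : deriv (fun x => Φ (x + ω)) z = deriv (fun x => Φ x + c) z := by rw [funext h]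
    rwa [deriv_comp_add_const, deriv_add_const] at this
  have hDper : ∀ z w, w ∈ L.lattice → D (z + w) = D z := by
    intro z w hw
    have := lattice_induction_iff L {u | D u = D z}
      (fun u => by rw [mem_setOf_eq, mem_setOf_eq, hDω h₁])
      (fun u => by rw [mem_setOf_eq, mem_setOf_eq, hDω h₂]) w hw z
    exact (this.mp rfl)
  have hb : ∀ z, D z = D 0 := fun z => hDd.apply_eq_apply_of_bounded
    (IsZLattice.isCompact_range_of_periodic L.lattice D hDd.continuous hDper).isBounded z 0
  have hd : ∀ x, HasDerivAt (fun z => Φ z - D 0 * z) (D x - D 0 * 1) x := fun x =>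
    (hΦ x).hasDerivAt.sub ((hasDerivAt_id' x).const_mul (D 0))
  have hlin : ∀ z, Φ z = D 0 * z + Φ 0 := by
    intro z
    have hc := is_const_of_deriv_eq_zero (fun x => (hd x).differentiableAt)
      (fun x => by rw [(hd x).deriv, hb x]; ring) z 0
    simp only [mul_zero, sub_zero] at hc
    linear_combination hc
  refine ⟨D 0, hlin, ?_, ?_⟩
  · have := h₁ 0
    rw [zero_add, hlin L.ω₁] at this
    linear_combination this
  · have := h₂ 0
    rw [zero_add, hlin L.ω₂] at this
    linear_combination this

/-- `ζ(w) = 1/w + Z₀(w)` off the lattice with `Z₀` analytic at `0`: writing `σ(z) = z · φ(z)` with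
`φ = ∏' (1 - z/l) e^{z/l + z²/(2l²)}` entire and `φ(0) = 1`, the logarithmic derivative
`ζ = σ'/σ` (Whittaker–Watson §20.42) is `1/z + φ'/φ`. [cite: WhittakerWatson1927, §20.42] -/
theorem exists_weierstrassZeta_eq_inv_add (L : PeriodPair) :
    ∃ Z₀ : ℂ → ℂ, AnalyticAt ℂ Z₀ 0 ∧
      ∀ w : ℂ, w ∉ L.lattice → L.weierstrassZeta w = 1 / w + Z₀ w := by
  set φ : ℂ → ℂ := fun z => ∏' l : L.lattice, PeriodPair.sigmaFactor z l with hφ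
  have hφd : Differentiable ℂ φ := L.differentiable_tprod_sigmaFactor
  have hφ0 : φ 0 = 1 := by simp [hφ, PeriodPair.sigmaFactor]
  refine ⟨logDeriv φ, ?_, ?_⟩
  · rw [logDeriv]
    exact (hφd.analyticAt 0).deriv.div (hφd.analyticAt 0) (by simp [hφ0])
  · intro w hw
    have hw0 : w ≠ 0 := by rintro rfl; exact hw (zero_mem _)
    have hP : φ w ≠ 0 := L.tprod_sigmaFactor_ne_zero hw
    have h1 := L.logDeriv_weierstrassSigma_holds w hw
    have h2 := logDeriv_mul (f := id) (g := φ) w hw0 hP differentiableAt_id (hφd w)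
    have hσ : L.weierstrassSigma = fun z => id z * φ z := rfl
    rw [← h1, hσ, h2, logDeriv_id]

/-- Transport of a removable singularity along a period: if `R` agrees near `z₀` (punctured) with
an analytic `g`, the good points `P` are generic and `R (w + ω) = R w + c` at good points, then `R`
agrees near `z₀ + ω` with the analytic `z ↦ g (z - ω) + c`. [folklore] -/
theorem rep_translate {R g : ℂ → ℂ} {P : ℂ → Prop} {ω c z₀ : ℂ}
    (hP : ∀ z, ∀ᶠ w in 𝓝[≠] z, P w) (hPω : ∀ w, P w → P (w - ω))
    (hc : ∀ w, P w → R (w + ω) = R w + c)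
    (hg : AnalyticAt ℂ g z₀) (hR : R =ᶠ[𝓝[≠] z₀] g) :
    ∃ g' : ℂ → ℂ, AnalyticAt ℂ g' (z₀ + ω) ∧ R =ᶠ[𝓝[≠] (z₀ + ω)] g' := by
  refine ⟨fun z => g (z - ω) + c, ?_, ?_⟩
  · exact (hg.fun_comp_of_eq (f := fun z => z - ω) (by fun_prop)
      (add_sub_cancel_right z₀ ω)).add analyticAt_const
  · filter_upwards [(tendsto_sub_const_nhdsNE z₀ ω).eventually hR, hP (z₀ + ω)] with z hz hPz
    have hz' : R (z - ω) = g (z - ω) := hz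
    have h := hc (z - ω) (hPω z hPz)
    rw [sub_add_cancel] at h
    rw [h, hz']

/-- Rewriting of the side condition `z ∉ v + Λ`. [folklore] -/
theorem forall_ne_add_iff (L : PeriodPair) (v z : ℂ) :
    (∀ l ∈ L.lattice, z ≠ v + l) ↔ z - v ∉ L.lattice := by
  constructor
  · intro h hz
    exact h _ hz (by ring)
  · rintro h l hl rfl
    exact h (by simpa using hl)

end EllipticLiouville

open EllipticLiouville in
/-- STUB `stub_ellipticLiouville` — **a `Λ`-periodic meromorphic function with at most one simple
pole per period class is constant.**  If `r` is analytic off `Λ ∪ (v + Λ)`, `Λ`-periodic there,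
extends analytically across `0`, and has at most a simple pole at `v ∉ Λ`, then `r` is constant off
`Λ ∪ (v + Λ)`: with `a` the residue, `r − a ζ(· − v)` extends to an entire function with constant
period defects `−a ηᵢ`, so its derivative is a bounded entire `Λ`-periodic function, hence constant
(Liouville); then `a (η₁ω₂ − η₂ω₁) = 0` and Legendre's relation `η₁ω₂ − η₂ω₁ = ±2πi` force
`a = 0`. [cite: WhittakerWatson1927, §20.12, §20.411] -/
theorem stub_ellipticLiouville (L : PeriodPair) (v : ℂ) (hv : v ∉ L.lattice) (r : ℂ → ℂ)
    (hana : ∀ z : ℂ, z ∉ L.lattice → (∀ l ∈ L.lattice, z ≠ v + l) → AnalyticAt ℂ r z)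
    (hper₁ : ∀ z : ℂ, z ∉ L.lattice → (∀ l ∈ L.lattice, z ≠ v + l) → r (z + L.ω₁) = r z)
    (hper₂ : ∀ z : ℂ, z ∉ L.lattice → (∀ l ∈ L.lattice, z ≠ v + l) → r (z + L.ω₂) = r z)
    (hrem : ∃ F₀ : ℂ → ℂ, AnalyticAt ℂ F₀ 0 ∧ ∀ᶠ z in 𝓝[≠] (0 : ℂ), r z = F₀ z)
    (hpole : ∃ F : ℂ → ℂ, AnalyticAt ℂ F v ∧ ∀ᶠ z in 𝓝[≠] v, r z = F z / (z - v)) :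
    ∃ c : ℂ, ∀ z : ℂ, z ∉ L.lattice → (∀ l ∈ L.lattice, z ≠ v + l) → r z = c := by
  obtain ⟨F₀, hF₀an, hF₀⟩ := hrem
  obtain ⟨F, hFan, hF⟩ := hpole
  obtain ⟨Z₀, hZ₀an, hZ₀⟩ := exists_weierstrassZeta_eq_inv_add L
  have hgood : ∀ z, (∀ l ∈ L.lattice, z ≠ v + l) ↔ z - v ∉ L.lattice := forall_ne_add_iff L v
  -- membership bookkeeping
  have hΛ : ∀ ω ∈ L.lattice, ∀ w : ℂ, w + ω ∈ L.lattice ↔ w ∈ L.lattice := fun ω hω w =>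
    ⟨fun h => by simpa using sub_mem h hω, fun h => add_mem h hω⟩
  -- the good points
  set P : ℂ → Prop := fun w => w ∉ L.lattice ∧ w - v ∉ L.lattice with hPdef
  have hPadd : ∀ ω ∈ L.lattice, ∀ w, P w → P (w + ω) := fun ω hω w h =>
    ⟨by rw [hΛ ω hω]; exact h.1, by rw [show w + ω - v = w - v + ω by ring, hΛ ω hω]; exact h.2⟩
  have hPsub : ∀ ω ∈ L.lattice, ∀ w, P w → P (w - ω) := fun ω hω w h => by
    rw [sub_eq_add_neg]; exact hPadd (-ω) (neg_mem hω) w h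
  have hPev : ∀ z, ∀ᶠ w in 𝓝[≠] z, P w := fun z =>
    ((eventually_sub_notMem_lattice L 0 z).and (eventually_sub_notMem_lattice L v z)).mono
      fun w hw => ⟨by simpa using hw.1, hw.2⟩
  -- `ζ` is analytic off `Λ`
  have hζan : ∀ w, w ∉ L.lattice → AnalyticAt ℂ L.weierstrassZeta w := fun w hw =>
    L.differentiableOn_weierstrassZeta_holds.analyticAt
      (L.isClosed_lattice.isOpen_compl.mem_nhds hw)
  have hζv : ∀ z, z - v ∉ L.lattice → AnalyticAt ℂ (fun z => L.weierstrassZeta (z - v)) z :=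
    fun z hz => (hζan _ hz).fun_comp_of_eq (f := fun w => w - v) (by fun_prop) rfl
  -- the function `R = r - a ζ(· - v)`, `a = F v`
  set R : ℂ → ℂ := fun z => r z - F v * L.weierstrassZeta (z - v) with hRdef
  have hRan : ∀ z, P z → AnalyticAt ℂ R z := fun z hz =>
    (hana z hz.1 ((hgood z).mpr hz.2)).sub (analyticAt_const.mul (hζv z hz.2))
  have hR₁ : ∀ w, P w → R (w + L.ω₁) = R w + -(F v * L.η₁) := by
    intro w hw
    simp only [hRdef]
    rw [hper₁ w hw.1 ((hgood w).mpr hw.2), show w + L.ω₁ - v = w - v + L.ω₁ by ring,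
      L.weierstrassZeta_add_ω₁_eq]
    ring
  have hR₂ : ∀ w, P w → R (w + L.ω₂) = R w + -(F v * L.η₂) := by
    intro w hw
    simp only [hRdef]
    rw [hper₂ w hw.1 ((hgood w).mpr hw.2), show w + L.ω₂ - v = w - v + L.ω₂ by ring,
      L.weierstrassZeta_add_ω₂_eq]
    ring
  have hR₁' : ∀ w, P w → R (w + -L.ω₁) = R w + F v * L.η₁ := by
    intro w hw
    have h := hR₁ (w - L.ω₁) (hPsub _ L.ω₁_mem_lattice w hw)
    rw [sub_add_cancel] at h
    rw [← sub_eq_add_neg, h]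
    ring
  have hR₂' : ∀ w, P w → R (w + -L.ω₂) = R w + F v * L.η₂ := by
    intro w hw
    have h := hR₂ (w - L.ω₂) (hPsub _ L.ω₂_mem_lattice w hw)
    rw [sub_add_cancel] at h
    rw [← sub_eq_add_neg, h]
    ring
  -- the set of points where `R` has (at worst) a removable singularity
  set S : Set ℂ := {z | ∃ g : ℂ → ℂ, AnalyticAt ℂ g z ∧ R =ᶠ[𝓝[≠] z] g} with hSdef
  have hSP : ∀ z, P z → z ∈ S := fun z hz => ⟨R, hRan z hz, EventuallyEq.rfl⟩
  have hS0 : (0 : ℂ) ∈ S := by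
    refine ⟨fun z => F₀ z - F v * L.weierstrassZeta (z - v), ?_, ?_⟩
    · exact hF₀an.sub (analyticAt_const.mul (hζv 0 (by rw [zero_sub, neg_mem_iff]; exact hv)))
    · exact hF₀.mono fun z hz => by simp only [hRdef]; rw [hz]
  have hSv : v ∈ S := by
    refine ⟨fun z => dslope F v z - F v * Z₀ (z - v), ?_, ?_⟩
    · obtain ⟨p, hp⟩ := hFan
      exact hp.has_fpower_series_dslope_fslope.analyticAt.sub
        (analyticAt_const.mul (hZ₀an.fun_comp_of_eq (f := fun w => w - v) (by fun_prop)
          (sub_self v)))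
    · filter_upwards [hF, self_mem_nhdsWithin, hPev v] with z hz hne hPz
      rw [mem_compl_iff, mem_singleton_iff] at hne
      have hzv : z - v ≠ 0 := sub_ne_zero.mpr hne
      simp only [hRdef]
      rw [hz, hZ₀ (z - v) hPz.2, dslope_of_ne _ hne, slope_def_field]
      field_simp
      ring
  -- translation invariance of `S`
  have hT : ∀ ω c, ω ∈ L.lattice → (∀ w, P w → R (w + ω) = R w + c) → ∀ z ∈ S, z + ω ∈ S :=
    fun ω c hω hc z ⟨g, hg, hRg⟩ => rep_translate hPev (hPsub ω hω) hc hg hRg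
  have h₁ : ∀ z, z ∈ S ↔ z + L.ω₁ ∈ S := fun z =>
    ⟨hT _ _ L.ω₁_mem_lattice hR₁ z, fun h => by
      have := hT _ _ (neg_mem L.ω₁_mem_lattice) hR₁' _ h
      rwa [add_neg_cancel_right] at this⟩
  have h₂ : ∀ z, z ∈ S ↔ z + L.ω₂ ∈ S := fun z =>
    ⟨hT _ _ L.ω₂_mem_lattice hR₂ z, fun h => by
      have := hT _ _ (neg_mem L.ω₂_mem_lattice) hR₂' _ h
      rwa [add_neg_cancel_right] at this⟩
  have hSall : ∀ z, z ∈ S := by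
    intro z
    by_cases hz : z ∈ L.lattice
    · simpa using (lattice_induction_iff L S h₁ h₂ z hz 0).mp hS0
    by_cases hzv : z - v ∈ L.lattice
    · have := (lattice_induction_iff L S h₁ h₂ (z - v) hzv v).mp hSv
      rwa [add_sub_cancel] at this
    · exact hSP z ⟨hz, hzv⟩
  -- the entire extension `Rt` of `R` and its period defects
  obtain ⟨Rt, hRtd, hRt⟩ := exists_differentiable_extension R hSall
  have hRtR : ∀ z, P z → Rt z = R z := fun z hz => hRt z R (hRan z hz) EventuallyEq.rfl
  have hRt₁ : ∀ z, Rt (z + L.ω₁) = Rt z + -(F v * L.η₁) := by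
    intro z₀
    refine eq_of_eventuallyEq_nhdsNE (f := fun z => Rt (z + L.ω₁))
      (g := fun z => Rt z + -(F v * L.η₁))
      (hRtd.continuous.comp (continuous_add_const _)).continuousAt
      (hRtd.continuous.add continuous_const).continuousAt ?_
    filter_upwards [hPev z₀] with z hz
    rw [hRtR z hz, hRtR (z + L.ω₁) (hPadd _ L.ω₁_mem_lattice z hz), hR₁ z hz]
  have hRt₂ : ∀ z, Rt (z + L.ω₂) = Rt z + -(F v * L.η₂) := by
    intro z₀
    refine eq_of_eventuallyEq_nhdsNE (f := fun z => Rt (z + L.ω₂))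
      (g := fun z => Rt z + -(F v * L.η₂))
      (hRtd.continuous.comp (continuous_add_const _)).continuousAt
      (hRtd.continuous.add continuous_const).continuousAt ?_
    filter_upwards [hPev z₀] with z hz
    rw [hRtR z hz, hRtR (z + L.ω₂) (hPadd _ L.ω₂_mem_lattice z hz), hR₂ z hz]
  -- Liouville and Legendre
  obtain ⟨b, hlin, hb₁, hb₂⟩ := entire_add_period L hRtd hRt₁ hRt₂
  have ha0 : F v = 0 := by
    have key : F v * (L.η₁ * L.ω₂ - L.η₂ * L.ω₁) = 0 := by
      linear_combination L.ω₂ * hb₁ - L.ω₁ * hb₂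
    have hπ : (2 * Real.pi * I : ℂ) ≠ 0 := by simp [Real.pi_ne_zero, I_ne_zero]
    rcases L.legendre_relation_up_to_sign with h | h
    · rw [h] at key
      exact (mul_eq_zero.mp key).resolve_right hπ
    · have key' : F v * (L.η₂ * L.ω₁ - L.η₁ * L.ω₂) = 0 := by linear_combination -key
      rw [h] at key'
      exact (mul_eq_zero.mp key').resolve_right hπ
  have hb0 : b = 0 := by
    have hω₁ : L.ω₁ ≠ 0 := by simpa using L.indep.ne_zero 0
    rw [ha0, zero_mul, neg_zero] at hb₁
    exact (mul_eq_zero.mp hb₁).resolve_right hω₁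
  refine ⟨Rt 0, fun z hz hzv => ?_⟩
  have h1 := hRtR z ⟨hz, (hgood z).mp hzv⟩
  have h2 := hlin z
  simp only [hRdef, ha0, zero_mul, sub_zero] at h1
  rw [hb0, zero_mul, zero_add] at h2
  rw [← h1, h2]

end Summit.KontsevichZagierPeriods.SymplecticScissors.RealOnePeriodRelations.TorsionLayer

end
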